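import Summits.BirchSwinnertonDyer.BirchSwinnertonDyer.Theorems.Rank2Observatory2DescKillSig12R
import Summits.BirchSwinnertonDyer.BirchSwinnertonDyer.Theorems.ShaPrimaryTransferFiniteShaComponentTransferSelmerCubicKillCertModSig12U
import HarnessLib

/-!
# BirchSwinnertonDyer — SEL2CUBIC kill layer: the certificate `sig12rCheck` in RESIDUE form

HONEST FRAMING: route `ShaPrimaryTransfer`, seat `bsd-line-spt-p1` (g30), `--supports` item T =
`FiniteShaComponentTransfer` (stmt-22356), UNCHANGED (conjecture-grade at corank ≥ 2). BSD in rank ≥ 2 is NOT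
proved by any of this. THEOREMS ONLY.

As `…SelmerCubicKillCertModSig12U`, for the TIER 2r signature certificate (one `ℤ_q`-root and the RAMIFIED
quadratic place, `Rank2Observatory2DescKillSig12R`): `sig12rCore_sound_mod`, `sig12rCheck_sound_mod` — the
tree's proofs verbatim with `root_rel_mod` / `quad_rel_mod` under the hypothesis `q^N ∣ Q₁(v), Q₂(v)`.
[cite: Cassels1991LecturesEllipticCurves, §15] [cite: CremonaAlgorithms1997, §3.6]
-/

-- single-conjunct summit: `Summit.BirchSwinnertonDyer.BirchSwinnertonDyer.…` repeats the name by design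
set_option linter.dupNamespace false

namespace Summit.BirchSwinnertonDyer.BirchSwinnertonDyer.Theorems.ShaPrimaryTransferSelmerCubicKill

open Summit.BirchSwinnertonDyer.BirchSwinnertonDyer.Rank2Observatory
open Summit.BirchSwinnertonDyer.BirchSwinnertonDyer.Rank2Observatory.TwoDescKill

/-- **Soundness of `sig12rCore`, residue form** (the tree's proof verbatim with `root_rel_mod`, `quad_rel_mod`).
[cite: Cassels1991LecturesEllipticCurves, §15] [cite: CremonaAlgorithms1997, §3.6] -/
theorem sig12rCore_sound_mod {q : ℕ} (hq : q.Prime) {a b c : ℤ} {z : ℤ × ℤ × ℤ} {t₁ t₂ : ℤ} {N : ℕ}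
    {ε h₁ h₀ r₁ Dp dlt : ℤ} {kd : ℕ} {He : ℤ} {D₀ : ℕ} {Hu : ℤ} {ρ : ℤ × ℕ × ℤ} {ZC ZB : ℤ} {s₂ : ℕ}
    {UC UB EC EB : ℤ} {k : ℕ} {Bu : ℤ}
    (h : sig12rCore q N c ε h₁ h₀ r₁ Dp dlt kd He D₀ Hu ρ ZC ZB s₂ UC UB EC EB k Bu = true)
    (hh₁ : h₁ = (a + ε) % ((q ^ N : ℕ) : ℤ)) (hh₀ : h₀ = (b + ε * h₁) % ((q ^ N : ℕ) : ℤ))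
    (hDp : Dp = (r₁ * r₁ - h₀) % ((q ^ N : ℕ) : ℤ)) (hHe : He = ((ε - r₁) ^ 2 - Dp) % ((q ^ N : ℕ) : ℤ))
    (hρ : ρ = rootData q N z t₁ t₂ ε)
    (hZC : ZC = (ev2 r₁ ((q ^ kd : ℕ) : ℤ) ((q : ℤ) * dlt) z).1 % ((q ^ N : ℕ) : ℤ))
    (hZB : ZB = (ev2 r₁ ((q ^ kd : ℕ) : ℤ) ((q : ℤ) * dlt) z).2 % ((q ^ N : ℕ) : ℤ))
    (hEC : EC = (ev2 r₁ ((q ^ kd : ℕ) : ℤ) ((q : ℤ) * dlt) ((0 : ℤ), t₁, t₂)).1 % ((q ^ N : ℕ) : ℤ))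
    (hEB : EB = (ev2 r₁ ((q ^ kd : ℕ) : ℤ) ((q : ℤ) * dlt) ((0 : ℤ), t₁, t₂)).2 % ((q ^ N : ℕ) : ℤ))
    (v : ℤ × ℤ × ℤ × ℤ) (hprim : ¬ ((q : ℤ) ∣ v.1 ∧ (q : ℤ) ∣ v.2.1 ∧ (q : ℤ) ∣ v.2.2.1 ∧ (q : ℤ) ∣ v.2.2.2))
    (h0 : (q : ℤ) ^ N ∣ (killQ a b c z t₁ t₂ v).1 ∧ (q : ℤ) ^ N ∣ (killQ a b c z t₁ t₂ v).2) :
    False := by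
  obtain ⟨x₀, x₁, x₂, n⟩ := v
  have hpZ : Prime (q : ℤ) := Nat.prime_iff_prime_int.mp hq
  have hq0 : (q : ℤ) ≠ 0 := by exact_mod_cast hq.ne_zero
  haveI : NeZero (q ^ N) := ⟨pow_ne_zero _ hq.ne_zero⟩
  have hMZ : ((q ^ N : ℕ) : ℤ) = (q : ℤ) ^ N := Nat.cast_pow q N
  simp only [sig12rCore, Bool.and_eq_true] at h
  obtain ⟨⟨⟨⟨⟨⟨⟨⟨⟨⟨⟨⟨⟨⟨-, hC2⟩, hC3⟩, hC4⟩, hC5⟩, hC6⟩, hC7⟩, hC8⟩, hC9⟩, hC10⟩, hC11⟩, hC12⟩,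
    hC13⟩, hC14⟩, hwalk⟩ := h
  simp only [decide_eq_true_eq] at hC2 hC3 hC4 hC6 hC9 hC10 hC12
  simp only [unitOK, Bool.not_eq_true', decide_eq_false_iff_not] at hC5 hC7 hC8 hC13
  -- units and primitivity
  have hdlt : ¬ (q : ℤ) ∣ dlt := fun hd => hC5 (Int.emod_eq_zero_of_dvd hd)
  have hHu : ¬ (q : ℤ) ∣ Hu := fun hd => hC7 (Int.emod_eq_zero_of_dvd hd)
  have hu₁ : ¬ (q : ℤ) ∣ ρ.2.2 := fun hd => hC8 (Int.emod_eq_zero_of_dvd hd)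
  have hU : ¬ ((q : ℤ) ∣ (UC, UB).1 ∧ (q : ℤ) ∣ (UC, UB).2) := by
    rintro ⟨hd1, hd2⟩
    simp [Int.emod_eq_zero_of_dvd hd1, Int.emod_eq_zero_of_dvd hd2] at hC11
  have hBu : ¬ (q : ℤ) ∣ Bu := fun hd => hC13 (Int.emod_eq_zero_of_dvd hd)
  have hBp : (q : ℤ) ∣ Bu - Bu % (q : ℤ) := (Int.mod_modEq _ _).dvd
  have hrat : ¬ (ramE q (UC, UB) = false ∧ eulerBit q ρ.2.2 =
      ramBit (eulerBit q (ramU q (UC, UB))) (eulerBit q (ramU q (UC, UB) * dlt)) (ρ.2.1 + s₂)) := by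
    rintro ⟨e1, e2⟩
    simp [e1, e2] at hC14
  rw [Nat.cast_pow] at hC4 hC6 hC9 hC10 hC12
  have hguard : 0 + (max ρ.2.1 (s₂ + 2 * kd + 1) + 2 * D₀) < N := walkR_guard hwalk
  have hS1 : ρ.2.1 ≤ max ρ.2.1 (s₂ + 2 * kd + 1) := le_max_left _ _
  have hS2 : s₂ + 2 * kd + 1 ≤ max ρ.2.1 (s₂ + 2 * kd + 1) := le_max_right _ _
  -- `D' = m·m·dl` with `m = q^{k_d}`, `dl = q·δ`
  set dl : ℤ := (q : ℤ) * dlt with hdl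
  have E5Z : Dp = ((q ^ kd : ℕ) : ℤ) * ((q ^ kd : ℕ) : ℤ) * dl := by
    rw [hC4, Nat.cast_pow, two_mul, pow_add]
  -- `h(ε) ≡ q^{D₀}·H_u (mod q^{D₀+1})`
  have hH : (q : ℤ) ^ (D₀ + 1) ∣ ((ε - r₁) ^ 2 - Dp) - (q : ℤ) ^ D₀ * Hu := by
    rw [← hC6, hHe, hMZ]
    exact dvd_trans (pow_dvd_pow _ (by omega)) (Int.mod_modEq _ _).dvd
  -- the coefficient identities in `ZMod (q^N)`
  have E1 : (h₁ : ZMod (q ^ N)) = (a : ZMod (q ^ N)) + ε := by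
    rw [hh₁, ZMod.intCast_mod]; push_cast; ring
  have E3 : (h₀ : ZMod (q ^ N)) = (b : ZMod (q ^ N)) + ε * h₁ := by
    rw [hh₀, ZMod.intCast_mod]; push_cast; ring
  have E4 : (Dp : ZMod (q ^ N)) = (r₁ : ZMod (q ^ N)) * r₁ - h₀ := by
    rw [hDp, ZMod.intCast_mod]; push_cast; ring
  have E5 : (Dp : ZMod (q ^ N)) = (((q ^ kd : ℕ) : ℤ) : ZMod (q ^ N)) * ((q ^ kd : ℕ) : ℤ) * dl := by
    rw [E5Z]; push_cast; ring
  have E2 : 2 * (r₁ : ZMod (q ^ N)) + h₁ = 0 := by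
    have := (ZMod.intCast_zmod_eq_zero_iff_dvd _ (q ^ N)).mpr (Int.dvd_of_emod_eq_zero hC3)
    push_cast at this
    exact this
  have E6 : (c : ZMod (q ^ N)) + ε * h₀ = 0 := by
    have := (ZMod.intCast_zmod_eq_zero_iff_dvd _ (q ^ N)).mpr (Int.dvd_of_emod_eq_zero hC2)
    push_cast at this
    exact this
  have ha' : (a : ZMod (q ^ N)) = -(ε : ZMod (q ^ N)) - 2 * (r₁ : ZMod (q ^ N)) := by
    linear_combination -E1 + E2
  have hb' : (b : ZMod (q ^ N)) = (r₁ : ZMod (q ^ N)) * r₁ -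
      (((q ^ kd : ℕ) : ℤ) : ZMod (q ^ N)) * ((q ^ kd : ℕ) : ℤ) * dl + 2 * (ε : ZMod (q ^ N)) * r₁ := by
    linear_combination -E3 + E4 - E5 - (ε : ZMod (q ^ N)) * E2
  have hc' : (c : ZMod (q ^ N)) = -((ε : ZMod (q ^ N)) * ((r₁ : ZMod (q ^ N)) * r₁ -
      (((q ^ kd : ℕ) : ℤ) : ZMod (q ^ N)) * ((q ^ kd : ℕ) : ℤ) * dl)) := by
    linear_combination E6 - (ε : ZMod (q ^ N)) * E4 + (ε : ZMod (q ^ N)) * E5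
  have hg : (ε ^ 3 + a * ε ^ 2 + b * ε + c) % ((q ^ N : ℕ) : ℤ) = 0 := by
    apply Int.emod_eq_zero_of_dvd
    apply (ZMod.intCast_zmod_eq_zero_iff_dvd _ (q ^ N)).mp
    push_cast
    linear_combination E6 - (ε : ZMod (q ^ N)) * E3 - (ε : ZMod (q ^ N)) ^ 2 * E1
  -- the root relation
  have REL1 : (q : ℤ) ^ N ∣ (q : ℤ) ^ ρ.2.1 * ρ.2.2 * (x₀ + x₁ * ε + x₂ * ε ^ 2) ^ 2 -
      ((zsq a b c z (x₀, x₁, x₂)).1 - n ^ 2 * ρ.1) := by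
    have h1 := root_rel_mod hg h0
    have h2 := splitPow_spec q N ((z.1 + z.2.1 * ε + z.2.2 * ε ^ 2) % ((q ^ N : ℕ) : ℤ))
    rw [hρ]
    simp only [rootData]
    rw [← h2]
    exact h1
  -- the pair relation
  set P : ℤ × ℤ := ev2 r₁ ((q ^ kd : ℕ) : ℤ) dl (x₀, x₁, x₂) with hP
  obtain ⟨REL2a, REL2b⟩ := quad_rel_mod (M := q ^ N) ha' hb' hc' (by push_cast; exact h0)
  rw [← hZC, ← hZB, ← hEC, hMZ] at REL2a
  rw [← hZC, ← hZB, ← hEB, hMZ] at REL2b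
  have eA1 : (pmul dl (ZC, ZB) (pmul dl P P)).1 = (q : ℤ) ^ s₂ * (pmul dl (UC, UB) (pmul dl P P)).1 := by
    simp only [pmul, hC9, hC10]; ring
  have eA2 : (pmul dl (ZC, ZB) (pmul dl P P)).2 = (q : ℤ) ^ s₂ * (pmul dl (UC, UB) (pmul dl P P)).2 := by
    simp only [pmul, hC9, hC10]; ring
  rw [eA1] at REL2a
  rw [eA2, hC12] at REL2b
  generalize hw₀ : (zsq a b c z (x₀, x₁, x₂)).1 = w₀ at REL1 REL2a REL2b
  -- the components of `P = ev2 x`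
  have hP1 : P.1 = x₀ + x₁ * r₁ + x₂ * (r₁ * r₁ + Dp) := by rw [hP, E5Z]; simp only [ev2]
  have hP2 : P.2 = ((q ^ kd : ℕ) : ℤ) * (x₁ + 2 * r₁ * x₂) := by rw [hP]; simp only [ev2]
  by_cases hn : (q : ℤ) ∣ n
  · -- `q ∣ n`: by the index lemma, `q^{D₀+1} ∤ r(ε)` or the pair value is not divisible by `q^{k_d+D₀+1}`
    have tri : ¬ (q : ℤ) ^ (D₀ + 1) ∣ x₀ + x₁ * ε + x₂ * ε ^ 2 ∨
        ¬ ((q : ℤ) ^ (kd + D₀ + 1) ∣ P.1 ∧ (q : ℤ) ^ (kd + D₀ + 1) ∣ P.2) := by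
      by_contra hcon
      push Not at hcon
      obtain ⟨hX, hPa, hPb⟩ := hcon
      have h2 : (q : ℤ) ^ (D₀ + 1) ∣ x₀ + x₁ * r₁ + x₂ * (r₁ * r₁ + Dp) := by
        rw [← hP1]; exact dvd_trans (pow_dvd_pow _ (by omega)) hPa
      have h3 : (q : ℤ) ^ (D₀ + 1) ∣ x₁ + 2 * r₁ * x₂ := by
        rw [hP2, Nat.cast_pow, show kd + D₀ + 1 = kd + (D₀ + 1) by omega, pow_add] at hPb
        exact (mul_dvd_mul_iff_left (pow_ne_zero kd hq0)).mp hPb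
      have hidx := indexR hq hHu hH hX h2 h3
      exact hprim ⟨hidx.1, hidx.2.1, hidx.2.2, hn⟩
    rcases tri with hX | hPnd
    · -- `q^{D₀+1} ∤ r(ε)`
      obtain ⟨μ, P₁, hPμ, hP₁, hμ⟩ := val_bound hq hu₁ (D := D₀) (R := x₀ + x₁ * ε + x₂ * ε ^ 2)
        hX (by omega) REL1
      by_cases hcmp : (q : ℤ) ^ (μ + 1) ∣ n ^ 2
      · exact ratR hq hdl hdlt hU hu₁ (by omega) hP₁ hPμ hcmp hrat ⟨_, REL1⟩ ⟨P, REL2a, REL2b⟩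
      · have hn0 : n ≠ 0 := by
          rintro rfl
          exact hcmp (by simp)
        obtain ⟨τ, n', hn', hnd⟩ : ∃ (k : ℕ) (x' : ℤ), n = (q : ℤ) ^ k * x' ∧ ¬ (q : ℤ) ∣ x' :=
          ⟨_, (Int.finiteMultiplicity_iff.mpr ⟨by simpa using hq.one_lt.ne', hn0⟩).exists_eq_pow_mul_and_not_dvd⟩
        have h2τ : 2 * τ ≤ μ := by
          by_contra hlt
          push Not at hlt
          apply hcmp
          rw [hn', mul_pow, ← pow_mul]
          exact dvd_mul_of_dvd_left (pow_dvd_pow _ (by omega)) _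
        obtain ⟨i, hi⟩ : ∃ i, μ = 2 * τ + i := ⟨μ - 2 * τ, by omega⟩
        have hw₀' : w₀ = (q : ℤ) ^ (2 * τ) * ((q : ℤ) ^ i * P₁ + n' ^ 2 * ρ.1) := by
          have e := hPμ
          rw [hi, pow_add, hn', mul_pow, ← pow_mul, mul_comm τ 2] at e
          linear_combination e
        exact kill_scaledR hq hu₁ hdl hdlt hU hBu hBp (τ := τ) (by omega) hwalk hw₀' hn' hnd
          ⟨_, REL1⟩ ⟨P, REL2a, REL2b⟩
    · -- the pair value is not divisible by `q^{k_d+D₀+1}`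
      obtain ⟨μ, W', hW1, hW2, hWp, hμ⟩ := val_boundR hq hdl hdlt hU (D := kd + D₀)
        (W := (w₀ - n ^ 2 * EC, -(n ^ 2 * ((q : ℤ) ^ k * Bu)))) hPnd (by omega) REL2a REL2b
      dsimp only at hW1 hW2
      by_cases hcmp : (q : ℤ) ^ (μ + 1) ∣ n ^ 2
      · obtain ⟨tt, htt⟩ := hcmp
        have htt' : n ^ 2 = (q : ℤ) ^ μ * ((q : ℤ) * tt) := by rw [htt, pow_succ]; ring
        have hW'2 : (q : ℤ) ∣ W'.2 := by
          have e : (q : ℤ) ^ μ * W'.2 = (q : ℤ) ^ μ * (-((q : ℤ) * tt * ((q : ℤ) ^ k * Bu))) := by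
            rw [← hW2, htt']; ring
          rw [mul_left_cancel₀ (pow_ne_zero μ hq0) e]
          exact ⟨-(tt * ((q : ℤ) ^ k * Bu)), by ring⟩
        have hW'1 : ¬ (q : ℤ) ∣ W'.1 := fun hd => hWp ⟨hd, hW'2⟩
        have hPr : w₀ - n ^ 2 * ρ.1 = (q : ℤ) ^ μ * (W'.1 + (q : ℤ) * tt * (EC - ρ.1)) := by
          linear_combination hW1 + (EC - ρ.1) * htt'
        have hunit : ¬ (q : ℤ) ∣ W'.1 + (q : ℤ) * tt * (EC - ρ.1) := by
          intro hd
          apply hW'1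
          simpa using dvd_sub hd (⟨tt * (EC - ρ.1), by ring⟩ : (q : ℤ) ∣ (q : ℤ) * tt * (EC - ρ.1))
        exact ratR hq hdl hdlt hU hu₁ (by omega) hunit hPr ⟨tt, htt⟩ hrat ⟨_, REL1⟩ ⟨P, REL2a, REL2b⟩
      · have hn0 : n ≠ 0 := by
          rintro rfl
          exact hcmp (by simp)
        obtain ⟨τ, n', hn', hnd⟩ : ∃ (k : ℕ) (x' : ℤ), n = (q : ℤ) ^ k * x' ∧ ¬ (q : ℤ) ∣ x' :=
          ⟨_, (Int.finiteMultiplicity_iff.mpr ⟨by simpa using hq.one_lt.ne', hn0⟩).exists_eq_pow_mul_and_not_dvd⟩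
        have h2τ : 2 * τ ≤ μ := by
          by_contra hlt
          push Not at hlt
          apply hcmp
          rw [hn', mul_pow, ← pow_mul]
          exact dvd_mul_of_dvd_left (pow_dvd_pow _ (by omega)) _
        obtain ⟨i, hi⟩ : ∃ i, μ = 2 * τ + i := ⟨μ - 2 * τ, by omega⟩
        have hw₀' : w₀ = (q : ℤ) ^ (2 * τ) * ((q : ℤ) ^ i * W'.1 + n' ^ 2 * EC) := by
          have e := hW1
          rw [hi, pow_add, hn', mul_pow, ← pow_mul, mul_comm τ 2] at e
          linear_combination e
        exact kill_scaledR hq hu₁ hdl hdlt hU hBu hBp (τ := τ) (by omega) hwalk hw₀' hn' hnd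
          ⟨_, REL1⟩ ⟨P, REL2a, REL2b⟩
  · -- `q ∤ n`: the walk at offset `0` with `y = w₀/n²`
    exact kill_scaledR hq hu₁ hdl hdlt hU hBu hBp (τ := 0) (by omega) hwalk (y₀ := w₀) (n' := n)
      (by simp) (by simp) hn ⟨_, REL1⟩ ⟨P, REL2a, REL2b⟩

/-- **Soundness of the TIER 2r certificate `sig12rCheck`, residue form.** [cite: CremonaAlgorithms1997, §3.6] -/
theorem sig12rCheck_sound_mod {q : ℕ} (hq : q.Prime) {a b c : ℤ} {z : ℤ × ℤ × ℤ} {t₁ t₂ : ℤ} {N : ℕ} {ε : ℤ}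
    (h : sig12rCheck q a b c z t₁ t₂ N ε = true) (v : ℤ × ℤ × ℤ × ℤ)
    (hprim : ¬ ((q : ℤ) ∣ v.1 ∧ (q : ℤ) ∣ v.2.1 ∧ (q : ℤ) ∣ v.2.2.1 ∧ (q : ℤ) ∣ v.2.2.2))
    (h0 : (q : ℤ) ^ N ∣ (killQ a b c z t₁ t₂ v).1 ∧ (q : ℤ) ^ N ∣ (killQ a b c z t₁ t₂ v).2) : False :=
  sig12rCore_sound_mod hq h rfl rfl rfl rfl rfl rfl rfl rfl rfl v hprim h0

end Summit.BirchSwinnertonDyer.BirchSwinnertonDyer.Theorems.ShaPrimaryTransferSelmerCubicKill
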